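import Summits.AtomisticToContinuum.Crystallization.Theorems.PalmUnimodularRigidityMinimiserShellsMeckePricing
import HarnessLib

/-!
# Mecke pricing of an almost-sure pointwise certificate (stub R2a″-C `stub_aeMeckePricing` of
# line `palm-good-law`, crux `ReggeStarCoercivity.DefectFreeCrystallizes`, stmt-AtomisticToContinuum-13603)

**Theorem** (`stub_aeMeckePricing`).  Let `P` be a point-stationary (`IsPointStationaryLaw`, the
Mecke / mass-transport identity) probability law on configurations of `ℝ³`, almost surely a rooted
`δ`-hard-core counting measure, and let `t : (configuration, atom) → ℝ` be a jointly measurable,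
bounded (`|t| ≤ M`), finite-range (`t μ y = 0` for `‖y‖ > R`) bond transfer with divergence at the
root `div t (μ) = ∫ (t μ y − t (θ_y μ) (−y)) dμ(y)`, `θ_y μ = μ.map (· − y)`.  If `P`-ALMOST SURELY
`e₀ ≤ h(μ) + div t(μ)` (`h(μ) = ½ ∫ V_LJ(‖y‖) dμ(y)`, the root energy) and moreover
`e₀ + c₀ ≤ h(μ) + div t(μ)` whenever `¬ G μ` (`c₀ ≥ 0`, `G` an arbitrary predicate), then
`e₀ + c₀ · P*(¬ G) ≤ E_P[h]` (`P*` = Mathlib's outer measure of the possibly non-measurable event).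

This is the almost-sure-hypothesis port of the LANDED all-configurations version
`PalmUnimodularRigidityMinimiserShells.MeckePricing.stub_meckePricing_unfolded` (crux
`MinimiserShells`, stmt-AtomisticToContinuum-9225), whose proof only ever consumed the pointwise
certificate almost surely.

**Proof.**  The landed `MeckePricing.exists_measurable_version` (Mecke applied to `ofReal ∘ (±t)`:
`E_P[sent±] = E_P[received±]`, all finite by the packing bound) provides a measurable, `P`-integrable
`F` with `E_P[F] = E_P[h]` and `F = h + div t` almost surely.  With the MEASURABLE event
`B = {e₀ + c₀ ≤ F}`: almost surely `e₀ + c₀ 1_B ≤ F` (certificate, first clause), whence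
`e₀ + c₀ P(B) ≤ E_P[F] = E_P[h]`; and `{¬ G} ⊆ B` up to a `P`-null set (certificate, second clause),
whence `P*(¬ G) ≤ P(B)` (`measure_mono_ae`).  All `[folklore]`.
-/

noncomputable section

open MeasureTheory
open scoped ENNReal

namespace Summit.AtomisticToContinuum.Crystallization.Theorems.PalmGoodLaw.AeMeckePricing

open Literature.Probability.Process (IsPointStationaryLaw IsRootedHardCore)
open Literature.MathematicalPhysics.StatisticalMechanics (lennardJones rootEnergy rootEnergy_def)
open Summit.AtomisticToContinuum.Crystallization.Theorems.MinimiserShells.Negative.LoadBearing (meanRootEnergy)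
open Summit.AtomisticToContinuum.Crystallization.Theorems.MinimiserShells.Negative.Rootedness (E3)
open Summit.AtomisticToContinuum.Crystallization.Theorems.PalmUnimodularRigidityMinimiserShells.MeckePricing
  (exists_measurable_version)

/-- **Pricing a measurable version** (the integration step).  If `F` is `P`-integrable with mean
`m`, measurable, and almost surely `e₀ ≤ F`, then for the measurable event `B = {e₀ + c₀ ≤ F}`
(any real `c₀`) one has `e₀ + c₀ · P(B) ≤ m`: integrate the almost-sure inequality
`e₀ + c₀ 1_B ≤ F`. [folklore] -/
theorem level_add_price_measure_le {P : Measure (Measure E3)} [IsProbabilityMeasure P]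
    {F : Measure E3 → ℝ} (hFm : Measurable F) (hFi : Integrable F P) (e₀ c₀ : ℝ)
    (hae : ∀ᵐ μ ∂P, e₀ ≤ F μ) :
    e₀ + c₀ * (P {μ | e₀ + c₀ ≤ F μ}).toReal ≤ ∫ μ, F μ ∂P := by
  set B : Set (Measure E3) := {μ | e₀ + c₀ ≤ F μ} with hB
  have hBm : MeasurableSet B := measurableSet_le measurable_const hFm
  -- almost surely `e₀ + c₀ 1_B ≤ F`
  have hpt : ∀ᵐ μ ∂P, e₀ + B.indicator (fun _ => c₀) μ ≤ F μ := by
    filter_upwards [hae] with μ hμ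
    by_cases hb : μ ∈ B
    · rw [Set.indicator_of_mem hb]
      exact hb
    · rw [Set.indicator_of_notMem hb, add_zero]
      exact hμ
  -- integrate
  have hind : Integrable (B.indicator fun _ => c₀) P := (integrable_const c₀).indicator hBm
  have hle := integral_mono_ae ((integrable_const e₀).fun_add hind) hFi hpt
  rw [integral_add (integrable_const e₀) hind, integral_const, probReal_univ, one_smul,
    integral_indicator_const c₀ hBm, smul_eq_mul, measureReal_def] at hle
  calc e₀ + c₀ * (P B).toReal = e₀ + (P B).toReal * c₀ := by rw [mul_comm]
    _ ≤ ∫ μ, F μ ∂P := hle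

/-- **stub_aeMeckePricing** (R2a″-C of line `palm-good-law`): Mecke pricing of an ALMOST-SURE
pointwise certificate.  For a point-stationary probability law `P` a.s. carried by rooted
`δ`-hard-core configurations, a jointly measurable bounded finite-range bond transfer `t`, an
arbitrary predicate `G`, a level `e₀` and a price `c₀ ≥ 0`: if almost surely
`e₀ ≤ h(μ) + div t(μ)`, and moreover `e₀ + c₀ ≤ h(μ) + div t(μ)` when `¬ G μ`, then
`e₀ + c₀ · P*(¬ G) ≤ E_P[h]` (`P*` = outer measure; Mecke kills `E_P[div t]` through the landed
measurable version `MeckePricing.exists_measurable_version` of `h + div t`). [folklore] -/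
theorem stub_aeMeckePricing :
    ∀ δ : ℝ, 0 < δ → ∀ P : Measure (Measure (EuclideanSpace ℝ (Fin 3))), IsProbabilityMeasure P →
      (∀ᵐ μ ∂P, IsRootedHardCore δ μ) → IsPointStationaryLaw P →
      ∀ R M : ℝ, ∀ t : Measure (EuclideanSpace ℝ (Fin 3)) → EuclideanSpace ℝ (Fin 3) → ℝ,
        (Measurable (Function.uncurry t) ∧ (∀ μ y, |t μ y| ≤ M) ∧ ∀ μ y, R < ‖y‖ → t μ y = 0) →
      ∀ G : Measure (EuclideanSpace ℝ (Fin 3)) → Prop, ∀ e₀ c₀ : ℝ, 0 ≤ c₀ →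
        (∀ᵐ μ ∂P,
          (e₀ ≤ (∫ y, lennardJones ‖y‖ ∂μ) / 2 +
              ∫ y, (t μ y - t (Measure.map (fun z => z - y) μ) (-y)) ∂μ) ∧
          (¬ G μ → e₀ + c₀ ≤ (∫ y, lennardJones ‖y‖ ∂μ) / 2 +
              ∫ y, (t μ y - t (Measure.map (fun z => z - y) μ) (-y)) ∂μ)) →
        e₀ + c₀ * (P {μ | ¬ G μ}).toReal ≤ ∫ μ, (∫ y, lennardJones ‖y‖ ∂μ) / 2 ∂P := by
  intro δ hδ P hP hcore hstat R M t htMR G e₀ c₀ hc₀ hcert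
  obtain ⟨ht, hM, hR⟩ := htMR
  obtain ⟨F, hFm, hFi, hFint, hFae⟩ := exists_measurable_version hδ P hcore hstat ht hM hR
  -- almost surely `e₀ ≤ F` (certificate, first clause, on the a.s. set where `F = h + div t`)
  have hae : ∀ᵐ μ ∂P, e₀ ≤ F μ := by
    filter_upwards [hcert, hFae] with μ hμ hF
    rw [hF, rootEnergy_def]
    exact hμ.1
  -- the outer measure of `{¬ G}` is at most `P {e₀ + c₀ ≤ F}` (certificate, second clause, a.s.)
  have hGB : P {μ | ¬ G μ} ≤ P {μ | e₀ + c₀ ≤ F μ} := by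
    refine measure_mono_ae ?_
    filter_upwards [hcert, hFae] with μ hμ hF hG
    show e₀ + c₀ ≤ F μ
    rw [hF, rootEnergy_def]
    exact hμ.2 hG
  -- price the measurable version and compare
  have hle := level_add_price_measure_le hFm hFi e₀ c₀ hae
  rw [hFint] at hle
  calc e₀ + c₀ * (P {μ | ¬ G μ}).toReal ≤ e₀ + c₀ * (P {μ | e₀ + c₀ ≤ F μ}).toReal :=
        add_le_add le_rfl
          (mul_le_mul_of_nonneg_left (ENNReal.toReal_mono (measure_ne_top P _) hGB) hc₀)
    _ ≤ meanRootEnergy P := hle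

end Summit.AtomisticToContinuum.Crystallization.Theorems.PalmGoodLaw.AeMeckePricing

end
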